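import Summits.CriticalPhenomena.CardyFormulaZ2.Theorems.CardyMagicRigidityMarkovCascadeDefs
import Summits.CriticalPhenomena.CardyFormulaZ2.Theorems.CardyMagicRigidityNestingRigidityBondLoopDensity
import Summits.CriticalPhenomena.CardyFormulaZ2.Theorems.CardyMagicRigidityNestingRigidityInterfaceLoopCylinder
import HarnessLib

/-!
# Microscopic loops of both types of the closed-b.c. `ℤ²` ball ensemble are dense away from the boundary

Helper toward crux `NestingRigidity` (stmt-CriticalPhenomena-4835), line `markov-cascade-one-generation`:
the closed-boundary-condition twin of `tendsto_measure_setOf_sparse_bondLoopConfig`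
(`…NestingRigidityBondLoopDensity.lean`) for the domain ensemble `domLoopsZ2 (ball 0 R) δ ω`
(typed interface loops of `ω ∩ meshEdges (ball 0 R) δ` visiting an edge of the discretised ball).

Proof: a deterministic reduction to the full-plane statement.  A member `u` of
`bondLoopConfig δ 0 ω` of type `i` whose trace lies in `ball z η` with `z ∈ closedBall 0 R₀` lies in
`ball 0 (R₀ + η)`; if `R₀ + η + |δ| ≤ R`, every entry of its dart list `γ` has both endpoints drawn in
`ball 0 R` (`IsInterfaceLoop.meshPoint_mem_ball_of_range_subset`), i.e. lies in
`meshEdges (ball 0 R) δ`, so by the cylinder property (`isInterfaceLoop_inter_iff`) `γ` is an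
interface loop of `ω ∩ meshEdges (ball 0 R) δ` of the same type visiting an edge of the discretised
ball: `u ∈ (domLoopsZ2 (ball 0 R) δ ω).F i` (`mem_domLoopsZ2_of_mem_bondLoopConfig`).  Hence the
"sparse" event for the domain ensemble is contained in the "sparse" event for the full-plane
ensemble (`setOf_sparse_domLoopsZ2_subset`), whose probability tends to `0`
(`tendsto_measure_setOf_sparse_bondLoopConfig`); `|δ| ≤ R - R₀ - η` holds eventually in `𝓝[>] 0`.
-/

noncomputable section

open MeasureTheory Set Filter
open scoped Topology BigOperators ENNReal Real

namespace Summit.CriticalPhenomena.CardyFormulaZ2.Cruxes.NestingRigidity.MarkovCascadeOneGeneration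

open Literature.Probability.RandomPlanarGeometry Literature.Probability.Percolation
  Literature.Probability.LatticeModels
open Summit.CriticalPhenomena.CardyFormulaZ2.Theses.CardyMagicRigidity

/-! ### Full-plane loops inside the window are loops of the closed-b.c. ball ensemble -/

/-- **Edges of a loop inside the window are edges of the discretised ball.** If the trace of
`loopCurve δ 0 γ` of an interface loop `γ` lies in `ball 0 r` and `r + |δ| ≤ R`, every entry of `γ`
belongs to `meshEdges (ball 0 R) δ` (its endpoints are within `|δ|` of its midpoint, which is on the
trace). [folklore] -/
theorem mem_meshEdges_ball_of_range_subset {ω : BondConfig (Site 2)} {γ : List MedialVertex}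
    (h : IsInterfaceLoop ω γ) {δ r R : ℝ} (hrR : r + |δ| ≤ R)
    (hγ : (loopCurve δ 0 γ).range ⊆ Metric.ball (0 : ℂ) r) {e : MedialVertex} (he : e ∈ γ) :
    e ∈ meshEdges (Metric.ball 0 R) δ :=
  fun _ hx ↦ Metric.ball_subset_ball hrR (h.meshPoint_mem_ball_of_range_subset hγ he hx)

/-- **A full-plane loop inside the window is a loop of the closed-b.c. ball ensemble, of the same
type.** If `u ∈ (bondLoopConfig δ 0 ω).F i` has trace in `ball 0 r` and `r + |δ| ≤ R`, then
`u ∈ (domLoopsZ2 (ball 0 R) δ ω).F i`: all entries of its dart list lie in `meshEdges (ball 0 R) δ`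
(`mem_meshEdges_ball_of_range_subset`), so the list is an interface loop of
`ω ∩ meshEdges (ball 0 R) δ` by the cylinder property (`isInterfaceLoop_inter_iff`), and it visits
an edge of the discretised ball since it is nonempty. [folklore] -/
theorem mem_domLoopsZ2_of_mem_bondLoopConfig {δ r R : ℝ} (hrR : r + |δ| ≤ R)
    {ω : BondConfig (Site 2)} {i : Fin 2} {u : UnbasedLoop ℂ} (hu : u ∈ (bondLoopConfig δ 0 ω).F i)
    (hr : u.range ⊆ Metric.ball (0 : ℂ) r) : u ∈ (domLoopsZ2 (Metric.ball 0 R) δ ω).F i := by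
  obtain ⟨γ, h, ht, rfl⟩ := hu
  have hM : ∀ e ∈ γ, e ∈ meshEdges (Metric.ball 0 R) δ := fun e he ↦
    mem_meshEdges_ball_of_range_subset h hrR hr he
  obtain ⟨e₀, he₀⟩ := List.exists_mem_of_ne_nil γ h.ne_nil
  exact ⟨γ, (isInterfaceLoop_inter_iff hM).2 h, ht, ⟨e₀, he₀, hM e₀ he₀⟩, rfl⟩

/-- **A loop of the closed-b.c. ball ensemble inside the window is a full-plane loop, of the same
type** (converse of `mem_domLoopsZ2_of_mem_bondLoopConfig`, same cylinder argument). [folklore] -/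
theorem mem_bondLoopConfig_of_mem_domLoopsZ2 {δ r R : ℝ} (hrR : r + |δ| ≤ R)
    {ω : BondConfig (Site 2)} {i : Fin 2} {u : UnbasedLoop ℂ}
    (hu : u ∈ (domLoopsZ2 (Metric.ball 0 R) δ ω).F i) (hr : u.range ⊆ Metric.ball (0 : ℂ) r) :
    u ∈ (bondLoopConfig δ 0 ω).F i := by
  obtain ⟨γ, h, ht, -, rfl⟩ := hu
  have hM : ∀ e ∈ γ, e ∈ meshEdges (Metric.ball 0 R) δ := fun e he ↦
    mem_meshEdges_ball_of_range_subset h hrR hr he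
  exact ⟨γ, (isInterfaceLoop_inter_iff hM).1 h, ht, rfl⟩

/-! ### The sparse event of the domain ensemble is contained in the full-plane one -/

/-- **Deterministic comparison of the two "sparse" events.** If `R₀ + η + |δ| ≤ R` and some point
`z ∈ closedBall 0 R₀` has, for some type `i`, no member of type `i` of `domLoopsZ2 (ball 0 R) δ ω`
with trace inside `ball z η`, then it has no such member of `bondLoopConfig δ 0 ω` either: such a
member would lie in `ball 0 (R₀ + η)` and hence belong to the domain ensemble
(`mem_domLoopsZ2_of_mem_bondLoopConfig`). [folklore] -/
theorem setOf_sparse_domLoopsZ2_subset {R R₀ η δ : ℝ} (h : R₀ + η + |δ| ≤ R) :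
    {ω : BondConfig (Site 2) | ∃ z ∈ Metric.closedBall (0 : ℂ) R₀, ∃ i : Fin 2,
        ∀ u ∈ (domLoopsZ2 (Metric.ball 0 R) δ ω).F i, ¬ u.range ⊆ Metric.ball z η} ⊆
      {ω | ∃ z ∈ Metric.closedBall (0 : ℂ) R₀, ∃ i : Fin 2,
        ∀ u ∈ (bondLoopConfig δ 0 ω).F i, ¬ u.range ⊆ Metric.ball z η} := by
  rintro ω ⟨z, hz, i, hzi⟩
  refine ⟨z, hz, i, fun u hu hur ↦ hzi u (mem_domLoopsZ2_of_mem_bondLoopConfig h hu ?_) hur⟩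
  rw [Metric.mem_closedBall] at hz
  exact hur.trans (Metric.ball_subset_ball' (by linarith))

/-- **Fixed-mesh bound** (quantitative form, from `measure_setOf_sparse_bondLoopConfig_le`). If the
finite set `t` is an `η/2`-net of `closedBall 0 R₀` and `R₀ + η + δ ≤ R`, then at mesh `δ > 0` the
event "some point of `closedBall 0 R₀` has, for some type, no member of `domLoopsZ2 (ball 0 R) δ ω`
of that type inside its `η`-ball" has `P_{1/2}`-probability at most
`|t| · 2 · (15/16)^{⌊η/(12δ)⌋}`. [folklore] -/
theorem measure_setOf_sparse_domLoopsZ2_le {R R₀ η : ℝ} (hη : 0 < η) {t : Finset ℂ}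
    (hcover : Metric.closedBall (0 : ℂ) R₀ ⊆ ⋃ z' ∈ t, Metric.ball z' (η / 2)) {δ : ℝ} (hδ : 0 < δ)
    (hR : R₀ + η + δ ≤ R) :
    P2 {ω | ∃ z ∈ Metric.closedBall (0 : ℂ) R₀, ∃ i : Fin 2,
        ∀ u ∈ (domLoopsZ2 (Metric.ball 0 R) δ ω).F i, ¬ u.range ⊆ Metric.ball z η} ≤
      (t.card : ℝ≥0∞) * (2 * ENNReal.ofReal ((1 - 1 / 16) ^ ⌊η / (12 * δ)⌋₊)) :=
  (measure_mono (setOf_sparse_domLoopsZ2_subset (by rwa [abs_of_pos hδ]))).trans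
    (measure_setOf_sparse_bondLoopConfig_le hη hcover hδ)

/-! ### Assembly -/

/-- **Microscopic interface loops of both types of the closed-b.c. critical bond percolation
ensemble on `δℤ² ∩ B(0, R)` are dense away from the boundary, with high probability.** For
`0 < η` and `R₀ + η < R`, the `P_{1/2}`-probability that some point `z` of `closedBall 0 R₀` has,
for some type `i`, **no** member of type `i` of `domLoopsZ2 (ball 0 R) δ ω` (typed interface loops
of `ω ∩ meshEdges (ball 0 R) δ` visiting an edge of the discretised ball) with trace inside
`ball z η` tends to `0` as `δ → 0⁺`: for `δ ≤ R - R₀ - η` the event is contained in the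
corresponding full-plane event (`setOf_sparse_domLoopsZ2_subset`: a full-plane loop inside
`ball z η ⊆ ball 0 (R₀ + η)` reads only edges of the discretised ball), whose probability tends to
`0` (`tendsto_measure_setOf_sparse_bondLoopConfig`: isolated vertices and faces with four open sides
are everywhere). [folklore] -/
theorem tendsto_measure_setOf_sparse_domLoopsZ2 : ∀ (R R₀ : ℝ) {η : ℝ}, 0 < η → R₀ + η < R → Tendsto (fun δ : ℝ ↦ P2 {ω | ∃ z ∈ Metric.closedBall (0 : ℂ) R₀, ∃ i : Fin 2, ∀ u ∈ (domLoopsZ2 (Metric.ball 0 R) δ ω).F i, ¬ u.range ⊆ Metric.ball z η}) (𝓝[>] 0) (𝓝 0) := by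
  intro R R₀ η hη hR
  refine tendsto_of_tendsto_of_tendsto_of_le_of_le' tendsto_const_nhds
    (tendsto_measure_setOf_sparse_bondLoopConfig R₀ hη) (Eventually.of_forall fun _ ↦ bot_le) ?_
  filter_upwards [Ioo_mem_nhdsGT (show (0 : ℝ) < R - R₀ - η by linarith)] with δ hδ
  refine measure_mono (setOf_sparse_domLoopsZ2_subset ?_)
  rw [abs_of_pos hδ.1]
  linarith [hδ.2]

end Summit.CriticalPhenomena.CardyFormulaZ2.Cruxes.NestingRigidity.MarkovCascadeOneGeneration

end
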